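import Mathlib
import Summits.Ventures.PercRepro2.Defs
import Summits.Ventures.PercRepro2.Harris
import Summits.Ventures.PercRepro2.Graph
import Summits.Ventures.PercRepro2.Events
import Summits.Ventures.PercRepro2.Induced
import Summits.Ventures.PercRepro2.BHK
import Summits.Ventures.PercRepro2.BHKEvents
import Summits.Ventures.PercRepro2.BHKAvoid
import Summits.Ventures.PercRepro2.ExploreA3
import Summits.Ventures.PercRepro2.RootLeafUSigns

/-!
# The doubly-centred two-level block family (A) — the (I3) theorem with free vertices
(blind cell PercRepro2, p4 g4; proofs/P4-G4U-T2.md §5, S3 (G4-u) (j))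

`I3_nonneg` (RootLeafUSigns) is the instance `x = c, y = b, z = o, s = u` of one family: for any
vertices `x, y, z, s` and the cluster `M = C(x)` explored under `x ↮ a₂`,

  `β·e·P(E) − e·P(E, y ∈ K) − β·d·P(E, z ∈ K) + d·P(E, y ∈ K, z ∈ K) ≥ 0`,

`E = {s ∈ C(x), x ↮ a₂}`, `K = C(a₂)`, `β = P(y ∈ K)`, `d = P(x ↮ a₂)`, `e = P(z ∈ K, x ↮ a₂)` — i.e.
`d·E[1_E (β − 1_{y∈K})(θ − 1_{z∈K})] ≥ 0` with the centring `θ = e/d = P(z ∈ K | x ↮ a₂)`.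
Proof: condition on `M`; Harris in `G ∖ M` (`p_{yz}(M) ≥ p_y(M) p_z(M)`); the functional BHK06 Thm 1.3
on `M` avoiding `a₂` (`bhk_induced`, `F₁ = 1 − p_z`, `F₂ = 1_{s ∈ ·}(β − p_y)`), and `θ = E_ν[p_z(M)]`.
These blocks are the two-level columns of the certificate search for `X5` (kit j243313 / j243613).
-/

namespace Summit.Ventures.PercRepro2

namespace RootLeafU

variable {V : Type*} {E : Type*} [Fintype E] [DecidableEq E] [Fintype V] [DecidableEq V]
  {R : Type*} [Field R] [LinearOrder R] [IsStrictOrderedRing R]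

section ABlock

variable (p : E → R) (ends : E → Sym2 V) (x y z s a₂ : V)

/-- **The (A)-block with free vertices** (cluster-event form): explore `M = C(x)` under `x ↮ a₂`. -/
theorem A_nonneg_cl (hp : IsProbVec p) :
    0 ≤ prob p (connEvent ends a₂ y) *
          prob p (clusterInEvent ends a₂ {W | z ∈ W} ∩ avoidAll ends x {a₂}) *
          prob p (clusterInEvent ends x {W | s ∈ W} ∩ avoidAll ends x {a₂})
        - prob p (clusterInEvent ends a₂ {W | z ∈ W} ∩ avoidAll ends x {a₂}) *
          prob p (clusterInEvent ends x {W | s ∈ W} ∩ clusterInEvent ends a₂ {W | y ∈ W} ∩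
            avoidAll ends x {a₂})
        - prob p (connEvent ends a₂ y) * prob p (avoidAll ends x {a₂}) *
          prob p (clusterInEvent ends x {W | s ∈ W} ∩ clusterInEvent ends a₂ {W | z ∈ W} ∩
            avoidAll ends x {a₂})
        + prob p (avoidAll ends x {a₂}) *
          prob p (clusterInEvent ends x {W | s ∈ W} ∩
            clusterInEvent ends a₂ ({W | z ∈ W} ∩ {W | y ∈ W}) ∩ avoidAll ends x {a₂}) := by
  classical
  set N := avoidAll ends x {a₂} with hN
  have ha2 : a₂ ∈ ({a₂} : Finset V) := by simp
  set gz := delClusterProb p ends a₂ {W | z ∈ W} with hgz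
  set gy := delClusterProb p ends a₂ {W | y ∈ W} with hgy
  set gzy := delClusterProb p ends a₂ ({W | z ∈ W} ∩ {W | y ∈ W}) with hgzy
  set β := prob p (connEvent ends a₂ y) with hβ
  set χ : Set V → R := fun K => ({W : Set V | s ∈ W}).indicator 1 K with hχ
  -- tower identities (exploring `C(x)` under `x ↮ a₂`)
  have tZ := prob_clusterIn_inter_avoid_eq_expect p ends x a₂ ha2 Set.univ {W | z ∈ W}
  have ts := prob_clusterIn_inter_avoid_eq_expect p ends x a₂ ha2 {W | s ∈ W} Set.univ
  have tsZ := prob_clusterIn_inter_avoid_eq_expect p ends x a₂ ha2 {W | s ∈ W} {W | z ∈ W}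
  have tsY := prob_clusterIn_inter_avoid_eq_expect p ends x a₂ ha2 {W | s ∈ W} {W | y ∈ W}
  have tsZY := prob_clusterIn_inter_avoid_eq_expect p ends x a₂ ha2 {W | s ∈ W}
    ({W | z ∈ W} ∩ {W | y ∈ W})
  have hg1 : ∀ K, delClusterProb p ends a₂ Set.univ K = 1 := delClusterProb_univ p ends a₂
  simp only [clusterInEvent_univ, Set.univ_inter, Set.inter_univ, Set.indicator_univ,
    Pi.one_apply, one_mul, hg1, mul_one] at tZ ts tsZ tsY tsZY
  -- pointwise Harris in the residual graph `G ∖ M`: `gz · gy ≤ gzy`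
  have hpt : ∀ K, gz K * gy K ≤ gzy K := by
    intro K
    simp only [hgz, hgy, hgzy, delClusterProb]
    have h := prob_mul_prob_le_prob_inter hp
      (ExploreA3.isUpperSet_delCluster ends a₂ K (ExploreA3.isUpperSet_mem z))
      (ExploreA3.isUpperSet_delCluster ends a₂ K (ExploreA3.isUpperSet_mem y))
    have e : {ω : Config E | cluster ends (delConfig ends K ω) a₂ ∈ {W | z ∈ W}} ∩
        {ω | cluster ends (delConfig ends K ω) a₂ ∈ {W | y ∈ W}} =
        {ω | cluster ends (delConfig ends K ω) a₂ ∈ {W | z ∈ W} ∩ {W | y ∈ W}} := by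
      ext ω
      simp only [Set.mem_setOf_eq, Set.mem_inter_iff]
    rw [e] at h
    exact h
  -- monotonicity and bounds
  have hgz_anti : Antitone gz := delClusterProb_anti p hp ends a₂ (ExploreA3.isUpperSet_mem z)
  have hgy_anti : Antitone gy := delClusterProb_anti p hp ends a₂ (ExploreA3.isUpperSet_mem y)
  have hgz1 : ∀ K, gz K ≤ 1 := delClusterProb_le_one p hp ends a₂ _
  have hgy_le : ∀ K, gy K ≤ β := delClusterProb_mem_le p ends hp a₂ y
  have hχ_mono : Monotone χ := by
    intro K K' h
    simp only [hχ]
    by_cases hs : s ∈ K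
    · have hs' : s ∈ K' := h hs
      simp [Set.indicator, hs, hs']
    · simp [Set.indicator, hs]
      split_ifs <;> norm_num
  have hχ0 : ∀ K, 0 ≤ χ K := fun K => Set.indicator_apply_nonneg fun _ => zero_le_one
  have hF₁ : Monotone (fun K => 1 - gz K) := fun K K' h => by simp only; linarith [hgz_anti h]
  have hF₁0 : ∀ K, 0 ≤ 1 - gz K := fun K => by linarith [hgz1 K]
  have hF₂ : Monotone (fun K => χ K * (β - gy K)) := by
    intro K K' h
    simp only
    have h1 := hχ_mono h
    have h2 : β - gy K ≤ β - gy K' := by linarith [hgy_anti h]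
    exact mul_le_mul h1 h2 (by linarith [hgy_le K]) (hχ0 K')
  have hF₂0 : ∀ K, 0 ≤ χ K * (β - gy K) := fun K => mul_nonneg (hχ0 K) (by linarith [hgy_le K])
  -- the functional BHK on the cluster of `x` avoiding `a₂`
  have key := bhk_induced p hp ends x hF₁ hF₂ hF₁0 hF₂0 Finset.univ {a₂} {a₂}
    (Finset.subset_univ _) (Finset.subset_univ _)
  simp only [Finset.inter_self, Finset.union_self, REvent_univ] at key
  have e : ∀ F : Set V → R, clusterObs ends Finset.univ x F * (avoidAll ends x {a₂}).indicator 1 =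
      fun ω => F (cluster ends ω x) * (avoidAll ends x {a₂}).indicator 1 ω := by
    intro F
    funext ω
    simp only [Pi.mul_apply, clusterObs_apply, clusterIn_univ]
  rw [e, e, e] at key
  simp only [Pi.mul_apply] at key
  have eN : prob p N = expect p fun ω => N.indicator 1 ω := prob_eq_expect_indicator p _
  -- the expectations in terms of masses
  have e1 : expect p (fun ω => (1 - gz (cluster ends ω x)) * N.indicator 1 ω) =
      prob p N - prob p (clusterInEvent ends a₂ {W | z ∈ W} ∩ N) := by
    rw [tZ, eN, ← expect_sub]
    congr 1
    funext ω
    simp only [Pi.sub_apply]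
    ring
  have e2 : expect p (fun ω => χ (cluster ends ω x) * (β - gy (cluster ends ω x)) *
      N.indicator 1 ω) =
      β * prob p (clusterInEvent ends x {W | s ∈ W} ∩ N) -
        prob p (clusterInEvent ends x {W | s ∈ W} ∩ clusterInEvent ends a₂ {W | y ∈ W} ∩ N) := by
    rw [ts, tsY, ← expect_const_mul, ← expect_sub]
    congr 1
    funext ω
    simp only [Pi.sub_apply, hχ]
    ring
  have e12 : expect p (fun ω => (1 - gz (cluster ends ω x)) *
      (χ (cluster ends ω x) * (β - gy (cluster ends ω x))) * N.indicator 1 ω) =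
      β * prob p (clusterInEvent ends x {W | s ∈ W} ∩ N) -
        prob p (clusterInEvent ends x {W | s ∈ W} ∩ clusterInEvent ends a₂ {W | y ∈ W} ∩ N) -
        β * prob p (clusterInEvent ends x {W | s ∈ W} ∩ clusterInEvent ends a₂ {W | z ∈ W} ∩ N) +
        expect p (fun ω => χ (cluster ends ω x) * gz (cluster ends ω x) *
          gy (cluster ends ω x) * N.indicator 1 ω) := by
    rw [ts, tsY, tsZ, ← expect_const_mul, ← expect_const_mul, ← expect_sub, ← expect_sub,
      ← expect_add]
    congr 1
    funext ω
    simp only [Pi.sub_apply, Pi.add_apply, hχ]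
    ring
  rw [e1, e2, e12] at key
  -- `E[χ gz gy 1_N] ≤ E[χ gzy 1_N] = P(s ∈ C(x), z ∈ K, y ∈ K, x ↮ a₂)`
  have hE : expect p (fun ω => χ (cluster ends ω x) * gz (cluster ends ω x) *
      gy (cluster ends ω x) * N.indicator 1 ω) ≤
      prob p (clusterInEvent ends x {W | s ∈ W} ∩
        clusterInEvent ends a₂ ({W | z ∈ W} ∩ {W | y ∈ W}) ∩ N) := by
    rw [tsZY]
    refine expect_mono hp fun ω => ?_
    have h1 := hpt (cluster ends ω x)
    have h2 := hχ0 (cluster ends ω x)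
    have h3 : (0 : R) ≤ N.indicator 1 ω := Set.indicator_apply_nonneg fun _ => zero_le_one
    simp only [hχ] at h2 ⊢
    calc ({W : Set V | s ∈ W}).indicator 1 (cluster ends ω x) * gz (cluster ends ω x) *
          gy (cluster ends ω x) * N.indicator 1 ω
        = ({W : Set V | s ∈ W}).indicator 1 (cluster ends ω x) *
            (gz (cluster ends ω x) * gy (cluster ends ω x)) * N.indicator 1 ω := by ring
      _ ≤ ({W : Set V | s ∈ W}).indicator 1 (cluster ends ω x) * gzy (cluster ends ω x) *
            N.indicator 1 ω := by
          exact mul_le_mul_of_nonneg_right (mul_le_mul_of_nonneg_left h1 h2) h3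
  have hn0 : 0 ≤ prob p N := prob_nonneg hp _
  nlinarith [key, hE, hn0]

/-- **The (A)-block in connection events**: with `β = P(a₂ ↔ y)`, `d = P(x ↮ a₂)`,
`e = P(a₂ ↔ z, x ↮ a₂)` and `E = {x ↔ s, x ↮ a₂}`,
`β·e·P(E) − e·P(E, a₂ ↔ y) − β·d·P(E, a₂ ↔ z) + d·P(E, a₂ ↔ z, a₂ ↔ y) ≥ 0`. -/
theorem A_nonneg (hp : IsProbVec p) :
    0 ≤ prob p (connEvent ends a₂ y) *
          prob p (connEvent ends a₂ z ∩ (connEvent ends x a₂)ᶜ) *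
          prob p (connEvent ends x s ∩ (connEvent ends x a₂)ᶜ)
        - prob p (connEvent ends a₂ z ∩ (connEvent ends x a₂)ᶜ) *
          prob p (connEvent ends x s ∩ connEvent ends a₂ y ∩ (connEvent ends x a₂)ᶜ)
        - prob p (connEvent ends a₂ y) * prob p (connEvent ends x a₂)ᶜ *
          prob p (connEvent ends x s ∩ connEvent ends a₂ z ∩ (connEvent ends x a₂)ᶜ)
        + prob p (connEvent ends x a₂)ᶜ *
          prob p (connEvent ends x s ∩ (connEvent ends a₂ z ∩ connEvent ends a₂ y) ∩
            (connEvent ends x a₂)ᶜ) := by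
  have h := A_nonneg_cl p ends x y z s a₂ hp
  simpa only [ExploreA3.clusterInEvent_mem_eq, clusterInEvent_mem_inter_eq, avoidAll_singleton_eq] using h

end ABlock

end RootLeafU

end Summit.Ventures.PercRepro2
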